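import Summits.QuantumFields.YangMills.Theorems.UnitScaleGibbsActionDerivativeSlotCalculus
import HarnessLib

/-!
# LINE 28 «GrossTransfer» (crux `MeanDeviationL`, stmt-QuantumFields-23083; crux of record `HistoryTailL`, stmt-QuantumFields-19936):
# the Schwinger–Dyson observable `∂_u A_W` VANISHES IDENTICALLY at commuting, orientation-constant configurations when the test field has
# zero net curl per orientation — the class-wide witness behind the NET-FLUX obstruction to `stub_linTest`'s identification step

Cell `ym3-torus` (YM ladder rung R3 = continuum SU(2) Yang–Mills on T³ — a RUNG, NOT the Clay problem: not d = 4, not infinite volume, not a mass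
gap); width seat `ym-ust-19936-w7` g16.  Helper `--supports stmt-QuantumFields-23083 --as helper`; THEOREMS ONLY (0 `def`, 0 `sorry`, default
heartbeats), over ✓`UnitScaleGibbsActionDerivativeSlotCalculus` (px17 g7: `word`, `slot`, `slotIns`, `slotBond`, `actionDeriv`, `sum_word_update`,
`word_update_zero`) used BY NAME.

THE POINT (bus 2026-08-29 18:47Z w5-19936 g16 «NET-FLUX», 18:52Z px5 g10, 18:59Z this seat).  LINE 28's skeleton v2 (`Cruxes/HistoryTailL/Lines/gross_transfer.lean`
5d16c6d70f019e13) proves its window second moment from `stub_linTest`, whose designed route is a POINTWISE identification, on the level-0 small-field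
event of a gauge box `G = [lo,hi]`, of the block-plaquette linear proxy `Σ_p linWeight j a p • (V(∂p) − 1)` (total weight `(L²)^j`, ✓`sum_linWeight`) with the three
Schwinger–Dyson observables `Y_α = (∂_{u_α} A_W)(V)` of FIXED test fields `u_α` whose curls are supported on plaquettes of `G` (margin-1 letters).  This file
records, in the slot calculus and in hypothesis form, why no such pointwise identification can exist for ANY box-local test field:

* `re_trace_sum_word_update_slotIns_of_commute` — if the four slot matrices of a plaquette pairwise commute, the four first-insertion words of
  `∂_u A_W` have total trace `Re tr((u₀ + u₁ − u₂ − u₃)·S₀S₁S₂S₃)`: the SIGNED SLOT SUM (lattice curl of `u` at `p`) times the plaquette word;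
* `actionDeriv_eq_sum_curl_of_commute` — hence `∂_u A_W(V) = −(1∕N)·Σ_p Re tr((du)_p · ρ(V(∂p)))` at every configuration whose slot factors commute on
  the plaquettes meeting `supp u` (abelian-diagonal configurations);
* ★ `actionDeriv_eq_zero_of_commute_of_orientationConst` — if moreover `ρ(V(∂p))` depends only on the orientation `(p.μ, p.ν)` on a plaquette set `S`
  carrying `supp u` (CONSTANT CURVATURE on the box) and the curl of `u` has ZERO SUM over `S` in every orientation class (for `supp(du) ⊂ Plaq(G)` this is
  the torus double count, w5-19936 g16's `orientationSum_eq_zero`), then `∂_u A_W(V) = 0` EXACTLY.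

CONSEQUENCE (the witness; prose, not typed here): at the abelian-diagonal configuration `V_b = diag(e^{ia_b}, e^{−ia_b})` with `a` the off-tree linear
potential of the box scaled to plaquette angle `f ≤ θ_K` (so `V` is its own axial-gauge representative, every `(μ,ν)`-plaquette of `G` equals
`diag(e^{if}, e^{−if})` and the event `PlaqSmallOn (boxPlaqs lo hi) θ_K` HOLDS), EVERY `Y_u` with `supp(du) ⊂ Plaq(G)` is `0`, every Bianchi∕cube pairing
is `0`, while the linear proxy has norm `(L²)^j·2|sin(f∕2)|`.  So no inequality «on the event, `‖proxy‖ ≤ C·Σ_α|Y_{u_α}| + ε`» holds with `ε²` below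
`L^{4j}θ_K² = L^{4j}(γL^{−K})^{3∕4}`, which exceeds the window target `C·γL^{−(K−j)}` by the factor `L^{3j}γ^{−1∕4}L^{K∕4} ≥ 1` in every window `N·j ≤ K`.
The registered `stub_linTest` is an INTEGRATED inequality and is NOT refuted by one configuration (indeed it is implied by the window text with `u := 0`);
what is closed is the pointwise route for the whole class «fixed box-local exact test 2-forms + Bianchi terms + sup-norm remainders».

HONEST SCOPE.  Finite sums and `tr(AB) = tr(BA)`; nothing probabilistic; proves NO stub and refutes NO registered statement; nothing of `stub_linTest`,
«ShallowFluxSecondMomentL», (Q), 23083∕23133∕23134, K1 (23532), `MeanDeviationL`, `HistoryTailL`, the rung R3, d = 4, a continuum limit or a mass gap is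
proved here; the Yang–Mills mass gap is NOT proved.

References: L. Gross, CMP **92** (1983) 137–162, Thm 2.2 and its proof (the observable `∂_u A` pairs the field with the curl `du` only) [GrossCMP1983];
M. Creutz, Quarks, Gluons and Lattices (2022) Ch. 11 (link derivatives of plaquette words) [Creutz2022].
-/

set_option autoImplicit false

noncomputable section

open scoped Matrix.Norms.Frobenius BigOperators
open Literature.MathematicalPhysics.QuantumFieldTheory.Balaban1983to89
open Summit.QuantumFields.YangMills.Theorems.UnitScaleGibbsActionDerivativeSlotCalculus
  (word slot slotIns slotBond actionDeriv sum_word_update word_update_zero rho_plaqHol_eq_word)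

namespace Summit.QuantumFields.YangMills.Theorems.GrossTransferActionDerivCommuting

/-! ## §1  One plaquette: the first-insertion words at commuting slots read the signed slot sum (the curl) -/

section OnePlaquette

variable {N : ℕ}

/-- Cyclicity with one commutation: if `S₀` commutes with `S₁`, `S₂`, `S₃` then `tr(S₀·X·S₁S₂S₃) = tr(X·S₀S₁S₂S₃)`. [folklore] -/
theorem trace_mul_mul_of_commute (S₀ S₁ S₂ S₃ X : Matrix (Fin N) (Fin N) ℂ)
    (h01 : S₀ * S₁ = S₁ * S₀) (h02 : S₀ * S₂ = S₂ * S₀) (h03 : S₀ * S₃ = S₃ * S₀) :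
    (S₀ * X * S₁ * S₂ * S₃).trace = (X * (S₀ * S₁ * S₂ * S₃)).trace := by
  have hc : S₁ * S₂ * S₃ * S₀ = S₀ * S₁ * S₂ * S₃ := by
    calc S₁ * S₂ * S₃ * S₀ = S₁ * S₂ * (S₃ * S₀) := by simp only [Matrix.mul_assoc]
      _ = S₁ * S₂ * (S₀ * S₃) := by rw [h03]
      _ = S₁ * (S₂ * S₀) * S₃ := by simp only [Matrix.mul_assoc]
      _ = S₁ * (S₀ * S₂) * S₃ := by rw [h02]
      _ = (S₁ * S₀) * S₂ * S₃ := by simp only [Matrix.mul_assoc]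
      _ = (S₀ * S₁) * S₂ * S₃ := by rw [h01]
  calc (S₀ * X * S₁ * S₂ * S₃).trace = (S₀ * (X * S₁ * S₂ * S₃)).trace := by simp only [Matrix.mul_assoc]
    _ = ((X * S₁ * S₂ * S₃) * S₀).trace := Matrix.trace_mul_comm _ _
    _ = (X * (S₁ * S₂ * S₃ * S₀)).trace := by simp only [Matrix.mul_assoc]
    _ = (X * (S₀ * S₁ * S₂ * S₃)).trace := by rw [hc]

/-- Cyclicity with one commutation, last slot but one: if `S₃` commutes with `S₀`, `S₁`, `S₂` then `tr(S₀S₁S₂·X·S₃) = tr(X·S₀S₁S₂S₃)`. [folklore] -/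
theorem trace_mul_mul_of_commute' (S₀ S₁ S₂ S₃ X : Matrix (Fin N) (Fin N) ℂ)
    (h30 : S₃ * S₀ = S₀ * S₃) (h31 : S₃ * S₁ = S₁ * S₃) (h32 : S₃ * S₂ = S₂ * S₃) :
    (S₀ * S₁ * S₂ * X * S₃).trace = (X * (S₀ * S₁ * S₂ * S₃)).trace := by
  have hc : S₃ * (S₀ * S₁ * S₂) = S₀ * S₁ * S₂ * S₃ := by
    calc S₃ * (S₀ * S₁ * S₂) = (S₃ * S₀) * S₁ * S₂ := by simp only [Matrix.mul_assoc]
      _ = (S₀ * S₃) * S₁ * S₂ := by rw [h30]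
      _ = S₀ * (S₃ * S₁) * S₂ := by simp only [Matrix.mul_assoc]
      _ = S₀ * (S₁ * S₃) * S₂ := by rw [h31]
      _ = S₀ * S₁ * (S₃ * S₂) := by simp only [Matrix.mul_assoc]
      _ = S₀ * S₁ * (S₂ * S₃) := by rw [h32]
      _ = S₀ * S₁ * S₂ * S₃ := by simp only [Matrix.mul_assoc]
  calc (S₀ * S₁ * S₂ * X * S₃).trace = ((S₀ * S₁ * S₂ * X) * S₃).trace := rfl
    _ = (S₃ * (S₀ * S₁ * S₂ * X)).trace := Matrix.trace_mul_comm _ _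
    _ = ((S₃ * (S₀ * S₁ * S₂)) * X).trace := by simp only [Matrix.mul_assoc]
    _ = ((S₀ * S₁ * S₂ * S₃) * X).trace := by rw [hc]
    _ = (X * (S₀ * S₁ * S₂ * S₃)).trace := Matrix.trace_mul_comm _ _

/-- Cyclicity, last slot: `tr(S₀S₁S₂S₃·X) = tr(X·S₀S₁S₂S₃)` (no commutation needed). [folklore] -/
theorem trace_mul_last (S₀ S₁ S₂ S₃ X : Matrix (Fin N) (Fin N) ℂ) :
    (S₀ * S₁ * S₂ * (S₃ * X)).trace = (X * (S₀ * S₁ * S₂ * S₃)).trace := by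
  calc (S₀ * S₁ * S₂ * (S₃ * X)).trace = ((S₀ * S₁ * S₂ * S₃) * X).trace := by simp only [Matrix.mul_assoc]
    _ = (X * (S₀ * S₁ * S₂ * S₃)).trace := Matrix.trace_mul_comm _ _

end OnePlaquette

/-! ## §2  The action derivative at commuting configurations is the curl pairing -/

section Slots

variable {N : ℕ} {P : Params} {j : ℕ} {G : Type} [GaugeGroup G]
  (ρ : G →* Matrix (Fin N) (Fin N) ℂ) (u : PBond P j → Matrix (Fin N) (Fin N) ℂ)

/-- **THE FOUR FIRST-INSERTION WORDS AT COMMUTING SLOTS.**  If the four slot matrices `S = (ρV_{b₀}, ρV_{b₁}, ρ(V_{b₂}⁻¹), ρ(V_{b₃}⁻¹))` of the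
plaquette `p` pairwise commute, then `Σ_{i<4} Re tr(word(S[i ↦ slotIns i])) = Re tr((u_{b₀} + u_{b₁} − u_{b₂} − u_{b₃})·word S)` — the first variation
of the plaquette word along `u` reads the SIGNED SLOT SUM (the lattice curl `(du)_p`) against the plaquette variable. [cite: Creutz2022, Ch. 11] -/
theorem re_trace_sum_word_update_slotIns_of_commute (V : GaugeField P j G) (p : Plaq P j)
    (hc : ∀ i l : Fin 4, slot ρ V p i * slot ρ V p l = slot ρ V p l * slot ρ V p i) :
    (∑ i : Fin 4, (word (Function.update (slot ρ V p) i (slotIns ρ u V p i))).trace.re) =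
      (((u (slotBond p 0) + u (slotBond p 1) - u (slotBond p 2) - u (slotBond p 3)) * word (slot ρ V p))).trace.re := by
  -- collect the four words into one sum of matrices
  have hsum : (∑ i : Fin 4, (word (Function.update (slot ρ V p) i (slotIns ρ u V p i))).trace.re) =
      (∑ i : Fin 4, word (Function.update (slot ρ V p) i (slotIns ρ u V p i))).trace.re := by
    rw [Matrix.trace_sum, Complex.re_sum]
  rw [hsum, sum_word_update]
  -- names for the slots and the insertions
  set S := slot ρ V p with hS
  have hD0 : slotIns ρ u V p 0 = u (slotBond p 0) * S 0 := by
    simp [slotIns, slot, slotBond, hS]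
  have hD1 : slotIns ρ u V p 1 = u (slotBond p 1) * S 1 := by
    simp [slotIns, slot, slotBond, hS]
  have hD2 : slotIns ρ u V p 2 = S 2 * (-u (slotBond p 2)) := by
    simp [slotIns, slot, slotBond, hS]
  have hD3 : slotIns ρ u V p 3 = S 3 * (-u (slotBond p 3)) := by
    simp [slotIns, slot, slotBond, hS]
  rw [hD0, hD1, hD2, hD3]
  have hw : word S = S 0 * S 1 * S 2 * S 3 := rfl
  -- the four traces
  have t0 : (u (slotBond p 0) * S 0 * S 1 * S 2 * S 3).trace = (u (slotBond p 0) * word S).trace := by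
    simp only [hw, Matrix.mul_assoc]
  have t1 : (S 0 * (u (slotBond p 1) * S 1) * S 2 * S 3).trace = (u (slotBond p 1) * word S).trace := by
    have := trace_mul_mul_of_commute (S 0) (S 1) (S 2) (S 3) (u (slotBond p 1)) (hc 0 1) (hc 0 2) (hc 0 3)
    simpa only [hw, Matrix.mul_assoc] using this
  have t2 : (S 0 * S 1 * (S 2 * -u (slotBond p 2)) * S 3).trace = -(u (slotBond p 2) * word S).trace := by
    have := trace_mul_mul_of_commute' (S 0) (S 1) (S 2) (S 3) (-u (slotBond p 2)) (hc 3 0) (hc 3 1) (hc 3 2)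
    rw [hw, ← Matrix.trace_neg, ← Matrix.neg_mul]
    simpa only [Matrix.mul_assoc] using this
  have t3 : (S 0 * S 1 * S 2 * (S 3 * -u (slotBond p 3))).trace = -(u (slotBond p 3) * word S).trace := by
    rw [trace_mul_last, hw, Matrix.neg_mul, Matrix.trace_neg]
  rw [Matrix.trace_add, Matrix.trace_add, Matrix.trace_add, t0, t1, t2, t3]
  simp only [Matrix.sub_mul, Matrix.add_mul, Matrix.trace_sub, Matrix.trace_add, Complex.add_re, Complex.sub_re,
    Complex.neg_re]
  ring

/-- **THE ACTION DERIVATIVE AT COMMUTING CONFIGURATIONS IS THE CURL PAIRING.**  If on every plaquette of a set `S` the four slot matrices pairwise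
commute, and `u` vanishes on every slot of every plaquette outside `S`, then
`∂_u A_W(V) = −(1∕N)·Σ_{p ∈ S} Re tr((u_{b₀} + u_{b₁} − u_{b₂} − u_{b₃})·ρ(V(∂p)))`. [cite: GrossCMP1983, Thm 2.2 (proof)] -/
theorem actionDeriv_eq_sum_curl_of_commute (V : GaugeField P j G) (S : Finset (Plaq P j))
    (hu : ∀ p, p ∉ S → ∀ i : Fin 4, u (slotBond p i) = 0)
    (hc : ∀ p ∈ S, ∀ i l : Fin 4, slot ρ V p i * slot ρ V p l = slot ρ V p l * slot ρ V p i) :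
    actionDeriv ρ u V =
      ∑ p ∈ S, -((((u (slotBond p 0) + u (slotBond p 1) - u (slotBond p 2) - u (slotBond p 3)) *
          ρ (GaugeField.plaqHol V p))).trace.re / N) := by
  classical
  unfold actionDeriv
  -- per plaquette: the inner sum of the four words
  have hin : ∀ p : Plaq P j, (∑ i : Fin 4, -((word (Function.update (slot ρ V p) i (slotIns ρ u V p i))).trace.re / N)) =
      -((∑ i : Fin 4, (word (Function.update (slot ρ V p) i (slotIns ρ u V p i))).trace.re) / N) := by
    intro p
    rw [Finset.sum_div, Finset.sum_neg_distrib]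
  simp_rw [hin]
  -- split the plaquette sum into `S` and its complement; outside `S` every insertion word vanishes
  rw [← Finset.sum_add_sum_compl S]
  have hout : ∑ p ∈ Sᶜ, -((∑ i : Fin 4, (word (Function.update (slot ρ V p) i (slotIns ρ u V p i))).trace.re) / N) = 0 := by
    refine Finset.sum_eq_zero fun p hp => ?_
    have hp' : p ∉ S := Finset.mem_compl.1 hp
    have h0 := hu p hp' 0
    have h1 := hu p hp' 1
    have h2 := hu p hp' 2
    have h3 := hu p hp' 3
    simp only [slotBond, Matrix.cons_val_zero, Matrix.cons_val_one, Matrix.head_cons, Matrix.cons_val_two,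
      Matrix.tail_cons, Matrix.cons_val_three] at h0 h1 h2 h3
    have hz : ∀ i : Fin 4, slotIns ρ u V p i = 0 := by
      intro i
      fin_cases i <;> simp [slotIns, h0, h1, h2, h3]
    simp [hz, word_update_zero]
  rw [hout, add_zero]
  refine Finset.sum_congr rfl fun p hp => ?_
  rw [re_trace_sum_word_update_slotIns_of_commute ρ u V p (hc p hp), rho_plaqHol_eq_word]

/-- ★ **`∂_u A_W` VANISHES AT COMMUTING, ORIENTATION-CONSTANT CONFIGURATIONS WHEN `u` HAS ZERO NET CURL PER ORIENTATION.**  Let `S` be a set of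
plaquettes carrying every slot of `u` (`u` vanishes on the slots of plaquettes outside `S`).  If on `S` the slot factors of `V` pairwise commute, the
plaquette variable `ρ(V(∂p)) = P(p.μ, p.ν)` depends only on the orientation (CONSTANT CURVATURE on the box), and the signed slot sums of `u` have zero sum
over `S` in every orientation class (for `supp(du)` inside the plaquettes of a gauge box this is the torus double count), then `∂_u A_W(V) = 0`.
This is the class-wide witness behind the NET-FLUX obstruction to LINE 28's identification step: at such `V` EVERY box-local Schwinger–Dyson observable
vanishes while the block-plaquette proxy `Σ_p linWeight j a p • (V(∂p) − 1) = (L²)^j·(P − 1)` does not. [cite: GrossCMP1983, Thm 2.2] -/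
theorem actionDeriv_eq_zero_of_commute_of_orientationConst (V : GaugeField P j G) (S : Finset (Plaq P j))
    (hu : ∀ p, p ∉ S → ∀ i : Fin 4, u (slotBond p i) = 0)
    (hc : ∀ p ∈ S, ∀ i l : Fin 4, slot ρ V p i * slot ρ V p l = slot ρ V p l * slot ρ V p i)
    (Pm : Fin P.d → Fin P.d → Matrix (Fin N) (Fin N) ℂ) (hP : ∀ p ∈ S, ρ (GaugeField.plaqHol V p) = Pm p.μ p.ν)
    (hsum : ∀ μ ν : Fin P.d,
      ∑ p ∈ S.filter (fun p => p.μ = μ ∧ p.ν = ν),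
        (u (slotBond p 0) + u (slotBond p 1) - u (slotBond p 2) - u (slotBond p 3)) = 0) :
    actionDeriv ρ u V = 0 := by
  classical
  rw [actionDeriv_eq_sum_curl_of_commute ρ u V S hu hc]
  -- abbreviate the curl
  set du : Plaq P j → Matrix (Fin N) (Fin N) ℂ :=
    fun p => u (slotBond p 0) + u (slotBond p 1) - u (slotBond p 2) - u (slotBond p 3) with hdu
  -- rewrite each term through the orientation-constant plaquette variable
  have h1 : ∑ p ∈ S, -(((du p) * ρ (GaugeField.plaqHol V p)).trace.re / N) =
      ∑ p ∈ S, -(((du p) * Pm p.μ p.ν).trace.re / N) :=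
    Finset.sum_congr rfl fun p hp => by rw [hP p hp]
  rw [h1]
  -- group the sum by orientation classes
  have h2 : ∑ p ∈ S, -(((du p) * Pm p.μ p.ν).trace.re / N) =
      ∑ μ : Fin P.d, ∑ ν : Fin P.d, ∑ p ∈ S.filter (fun p => p.μ = μ ∧ p.ν = ν), -(((du p) * Pm μ ν).trace.re / N) := by
    have : ∀ p ∈ S, -(((du p) * Pm p.μ p.ν).trace.re / N) =
        ∑ μ : Fin P.d, ∑ ν : Fin P.d, if p.μ = μ ∧ p.ν = ν then -(((du p) * Pm μ ν).trace.re / N) else 0 := by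
      intro p _
      rw [Finset.sum_eq_single p.μ, Finset.sum_eq_single p.ν]
      · simp
      · intro ν _ hν; simp [Ne.symm hν]
      · simp
      · intro μ _ hμ; exact Finset.sum_eq_zero fun ν _ => by simp [Ne.symm hμ]
      · simp
    rw [Finset.sum_congr rfl this, Finset.sum_comm]
    refine Finset.sum_congr rfl fun μ _ => ?_
    rw [Finset.sum_comm]
    refine Finset.sum_congr rfl fun ν _ => ?_
    rw [Finset.sum_filter]
  rw [h2]
  refine Finset.sum_eq_zero fun μ _ => Finset.sum_eq_zero fun ν _ => ?_
  -- inside one orientation class the plaquette variable is constant: pull it out of the sum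
  have h3 : ∑ p ∈ S.filter (fun p => p.μ = μ ∧ p.ν = ν), -(((du p) * Pm μ ν).trace.re / N) =
      -(((∑ p ∈ S.filter (fun p => p.μ = μ ∧ p.ν = ν), du p) * Pm μ ν).trace.re / N) := by
    rw [Finset.sum_mul, Matrix.trace_sum, Complex.re_sum, Finset.sum_div, Finset.sum_neg_distrib]
  rw [h3, hsum μ ν, Matrix.zero_mul, Matrix.trace_zero, Complex.zero_re, zero_div, neg_zero]

end Slots

end Summit.QuantumFields.YangMills.Theorems.GrossTransferActionDerivCommuting

end
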